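import Summits.HubbardSuperconductivity.HubbardSuperconductivity.Theorems.AnisotropyChordChordXYFourToolkit

/-!
# Route `AnisotropyChord` / crux `ChordXY` at `M = 4`: the NEAR piece `Δ ∈ [−17/200, 0]` — a first-order perturbative certificate
# at the touching point `Δ = 0` (prover seat `hubbard-h0-rotor-p1` g18)

At `Δ = 0` the chord `(1+Δ)Λ₄(0) ≤ Λ₄(Δ)` is an equality, so no operator inequality with finite constants certifies it; instead:
decompose the Perron amplitude `a₁` of `H₄(Δ)` as `c·a₀ + w`, `w ⊥ a₀` (`a₀` the Perron amplitude of `H₄(0)`, `c = ⟨a₀,a₁⟩ ≥ 0`,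
`‖w‖² = 1 − c²`).  (1) GAP: the rank-one-shifted certificate `certX0` on `span(a₀, w)` and the eigen-equation of `a₀` give
`𝓔₀(w) ≥ (19/10)‖w‖²` by elementary interlacing (`gap_of_rankOne`); (2) VARIATIONAL COMPARISON `𝓔_Δ(a₁) ≤ 𝓔_Δ(a₀)` and
`𝓔_Δ = 𝓔₀ − Δ·𝒲` give `g‖w‖² ≤ |Δ|(𝒲(a₀) − 𝒲(a₁))` with `g = 19/10 − R̃₀ ≥ 289/100`; (3) `𝒲(a₀) − 𝒲(a₁) ≤ (27/4)‖w‖² + 2√(23/10)‖w‖`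
(`⟨W⟩₀ ≤ −5/4`, `W ≥ −8`, Cauchy–Schwarz with the variance bound `‖(W+3/2)a₀‖² ≤ 23/10`), hence `‖w‖² ≤ 1.72·Δ²`;
(4) `Λ(a₁) ≥ c²Λ₀ − 2|Λ_B(a₀,w)|` and the `2 × 2` compression bound `Λ_B² ≤ Λ₀(289/4 − Λ₀)‖w‖²` (`cross_sq_le`, ceiling certificate
`289N − 4L ⪰ 0`), with `Λ₀ ∈ [133/2, 139/2]`, close `(1+Δ)Λ₀ ≤ Λ(a₁)` for `|Δ| ≤ 17/200`.
Main result: `lowerNormSq_ge_near`.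
-/

set_option linter.style.longLine false
set_option linter.dupNamespace false
set_option autoImplicit false

open Finset
open Literature.MathematicalPhysics.QuantumLattice Literature.Probability.LatticeModels
open Summit.HubbardSuperconductivity.HubbardSuperconductivity.Theorems.AnisotropyChord.Tower
open Summit.HubbardSuperconductivity.HubbardSuperconductivity.Theorems.AnisotropyChord.InsertionEntropy

namespace Summit.HubbardSuperconductivity.HubbardSuperconductivity.Theorems.AnisotropyChord.FourTorus

set_option maxHeartbeats 4000000 in
/-- **THE NEAR PIECE:** for `−17/200 ≤ Δ ≤ 0`, the sector-`0` Perron amplitudes `a₀` of `H₄(0)` and `a₁` of `H₄(Δ)` satisfy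
`(1 + Δ)·‖S⁻a₀‖² ≤ ‖S⁻a₁‖²`.  (One long structured proof; the heartbeat budget is raised for it.) [folklore] -/
theorem lowerNormSq_ge_near {Δ : ℝ} (h1 : -17/200 ≤ Δ) (h2 : Δ ≤ 0)
    {a₀ : Cfg → ℝ} (ha₀ : IsPerronSectorGroundAmplitude 4 0 0 a₀)
    {a₁ : Cfg → ℝ} (ha₁ : IsPerronSectorGroundAmplitude 4 Δ 0 a₁) :
    (1 + Δ) * lowerNormSq a₀ ≤ lowerNormSq a₁ := by
  -- notation
  set E8 := lowestEnergyInSector 1 (xxzHamiltonian 1 (torusGraph 2 4) (-1) 0) 0 + 8 with hE8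
  set d : ℝ := -Δ with hd
  have hd0 : 0 ≤ d := by linarith
  have hd1 : d ≤ 17/200 := by linarith
  -- the decomposition `a₁ = c a₀ + w`
  set c : ℝ := ∑ σ, a₀ σ * a₁ σ with hc
  set w : Cfg → ℝ := fun σ => a₁ σ - c * a₀ σ with hw
  have hc0 : 0 ≤ c := Finset.sum_nonneg fun σ _ => mul_nonneg (ha₀.nonneg σ) (ha₁.nonneg σ)
  have horth : ∑ σ, a₀ σ * w σ = 0 := by
    simp only [hw, mul_sub, Finset.sum_sub_distrib]
    rw [show ∑ σ, a₀ σ * (c * a₀ σ) = c * ∑ σ, a₀ σ ^ 2 by rw [Finset.mul_sum]; exact Finset.sum_congr rfl fun σ _ => by ring,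
      ha₀.unit]; rw [← hc]; ring
  set n : ℝ := ∑ σ, w σ ^ 2 with hn
  have hn_eq : n = 1 - c ^ 2 := by
    have e : ∀ σ, w σ ^ 2 = a₁ σ ^ 2 - 2 * c * (a₀ σ * a₁ σ) + c ^ 2 * a₀ σ ^ 2 := by intro σ; simp only [hw]; ring
    simp only [hn, e, Finset.sum_add_distrib, Finset.sum_sub_distrib, ← Finset.mul_sum, ha₀.unit, ha₁.unit, ← hc]; ring
  have hn0 : 0 ≤ n := Finset.sum_nonneg fun σ _ => sq_nonneg _
  have hc1 : c ≤ 1 := by nlinarith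
  have ha₁_eq : a₁ = fun σ => c * a₀ σ + 1 * w σ := by funext σ; simp only [hw]; ring
  -- symmetry
  have hs₀ := symAmp_of_perron ha₀
  have hs₁ := symAmp_of_perron ha₁
  have hsw : SymAmp w := by
    have := hs₁.lin hs₀ 1 (-c)
    convert this using 1; funext σ; simp only [hw]; ring
  -- (A) the eigen-equation of `a₀` kills the energy cross term
  have heig : ∀ σ, fmOp (torusGraph 2 4) a₀ σ + isingW (torusGraph 2 4) σ * a₀ σ = E8 * a₀ σ := by
    intro σ
    have h := perron_eigen_real ha₀ σ
    rw [torus4_degree_sum] at h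
    rw [hE8]; linarith [h]
  have hcross : ∑ σ, w σ * (fmOp (torusGraph 2 4) a₀ σ + isingW (torusGraph 2 4) σ * a₀ σ) = 0 := by
    simp_rw [heig]
    rw [show ∑ σ, w σ * (E8 * a₀ σ) = E8 * ∑ σ, a₀ σ * w σ by rw [Finset.mul_sum]; exact Finset.sum_congr rfl fun σ _ => by ring,
      horth, mul_zero]
  -- energies
  set Ew := ∑ σ, w σ * (fmOp (torusGraph 2 4) w σ + isingW (torusGraph 2 4) σ * w σ) with hEw
  have hE0 : ∑ σ, a₀ σ * (fmOp (torusGraph 2 4) a₀ σ + isingW (torusGraph 2 4) σ * a₀ σ) = E8 := by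
    have h := perron_energy_four ha₀
    simp only [sub_zero, one_mul] at h
    rw [hE8]; exact h
  -- (B) GAP: `Ew ≥ (19/10) n` from `certX0` on `span(a₀, w)`
  have hgap : 19 / 10 * n ≤ Ew := by
    have hnw := nw0c_val
    refine gap_of_rankOne (e := E8) (θ := 19/10) (t := 7 / (2 * (nw0c : ℝ)))
      (u₀ := linC w0 (fun r => a₀ (decode (rep8 r)))) (u₁ := linC w0 (fun r => w (decode (rep8 r))))
      (by have := e8_zero_le; rw [← hE8] at this; linarith) ?_
    intro α β
    have hsb : SymAmp (fun σ => α * a₀ σ + β * w σ) := hs₀.lin hsw α β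
    obtain ⟨hN, hW, -, hA⟩ := hsb.forms
    have hX := certX0 (fun r => α * a₀ (decode (rep8 r)) + β * w (decode (rep8 r)))
    -- energy and norm of `α a₀ + β w`
    have hEn : hopC (fun r => α * a₀ (decode (rep8 r)) + β * w (decode (rep8 r)))
        + isingC (fun r => α * a₀ (decode (rep8 r)) + β * w (decode (rep8 r))) = α ^ 2 * E8 + β ^ 2 * Ew := by
      rw [← hA, ← hW]
      have h := energy_lin (torusGraph 2 4) α β a₀ w
      rw [hcross, hE0, mul_zero, add_zero] at h
      rw [← h, ← Finset.sum_add_distrib]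
      exact Finset.sum_congr rfl fun σ _ => by ring
    have hNn : normC (fun r => α * a₀ (decode (rep8 r)) + β * w (decode (rep8 r))) = α ^ 2 + β ^ 2 * n := by
      rw [← hN]
      have e : ∀ σ, (α * a₀ σ + β * w σ) ^ 2 = α ^ 2 * a₀ σ ^ 2 + 2 * α * β * (a₀ σ * w σ) + β ^ 2 * w σ ^ 2 := by intro σ; ring
      simp only [e, Finset.sum_add_distrib, ← Finset.mul_sum, ha₀.unit, horth, hn]; ring
    have hLin : linC w0 (fun r => α * a₀ (decode (rep8 r)) + β * w (decode (rep8 r)))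
        = α * linC w0 (fun r => a₀ (decode (rep8 r))) + β * linC w0 (fun r => w (decode (rep8 r))) := by
      unfold linC; rw [Finset.mul_sum, Finset.mul_sum, ← Finset.sum_add_distrib]
      exact Finset.sum_congr rfl fun r _ => by ring
    rw [hLin, hNn] at hX
    have hE2 : 20 * hopC (fun r => α * a₀ (decode (rep8 r)) + β * w (decode (rep8 r)))
        + 20 * isingC (fun r => α * a₀ (decode (rep8 r)) + β * w (decode (rep8 r))) = 20 * (α ^ 2 * E8 + β ^ 2 * Ew) := by
      rw [← hEn]; ring
    have hpos : (0 : ℝ) < (nw0c : ℝ) := by rw [hnw]; norm_num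
    -- divide the certificate by `20 · nw0c`
    have hX' : 0 ≤ (nw0c : ℝ) * (20 * (α ^ 2 * E8 + β ^ 2 * Ew) - 38 * (α ^ 2 + β ^ 2 * n))
        + 70 * (α * linC w0 (fun r => a₀ (decode (rep8 r))) + β * linC w0 (fun r => w (decode (rep8 r)))) ^ 2 := by
      nlinarith [hX, hE2]
    have key : α ^ 2 * (E8 - 19 / 10) + β ^ 2 * (Ew - 19 / 10 * n)
        + 7 / (2 * (nw0c : ℝ)) * (α * linC w0 (fun r => a₀ (decode (rep8 r))) + β * linC w0 (fun r => w (decode (rep8 r)))) ^ 2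
        = ((nw0c : ℝ) * (20 * (α ^ 2 * E8 + β ^ 2 * Ew) - 38 * (α ^ 2 + β ^ 2 * n))
          + 70 * (α * linC w0 (fun r => a₀ (decode (rep8 r))) + β * linC w0 (fun r => w (decode (rep8 r)))) ^ 2) / (20 * (nw0c : ℝ)) := by
      field_simp; ring
    rw [key]; positivity
  -- (C) variational comparison at `Δ`: `𝓔_Δ(a₁) ≤ 𝓔_Δ(a₀)`
  have hsupp : ∀ σ, a₀ σ ≠ 0 → zerosCard σ = (Fintype.card (TorusSite 2 4) : ℝ) / 2 + 0 := fun σ h => perron_support ha₀ σ h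
  have hRR := rayleigh_real (L := 4) Δ 0 a₀ hsupp
  rw [torus4_degree_sum, ha₀.unit] at hRR
  have hE1 := perron_energy_four ha₁
  -- split the `Δ`-energies into `𝓔₀ − Δ·𝒲`
  have hsplit : ∀ b : Cfg → ℝ, ∑ σ, b σ * (fmOp (torusGraph 2 4) b σ + (1 - Δ) * (isingW (torusGraph 2 4) σ * b σ))
      = (∑ σ, b σ * (fmOp (torusGraph 2 4) b σ + isingW (torusGraph 2 4) σ * b σ)) - Δ * ∑ σ, isingW (torusGraph 2 4) σ * b σ ^ 2 := by
    intro b; rw [Finset.mul_sum, ← Finset.sum_sub_distrib]; exact Finset.sum_congr rfl fun σ _ => by ring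
  rw [hsplit] at hRR hE1
  rw [hE0] at hRR
  -- `𝓔₀(a₁) = c² E8 + Ew`
  have hEa1 : ∑ σ, a₁ σ * (fmOp (torusGraph 2 4) a₁ σ + isingW (torusGraph 2 4) σ * a₁ σ) = c ^ 2 * E8 + Ew := by
    have h := energy_lin (torusGraph 2 4) c 1 a₀ w
    rw [hcross, hE0, mul_zero, add_zero, one_pow, one_mul] at h
    rw [ha₁_eq]; exact h
  rw [hEa1] at hE1
  -- the Ising diagonals
  set W0 := ∑ σ, isingW (torusGraph 2 4) σ * a₀ σ ^ 2 with hW0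
  set WB := ∑ σ, isingW (torusGraph 2 4) σ * a₀ σ * w σ with hWB
  set Ww := ∑ σ, isingW (torusGraph 2 4) σ * w σ ^ 2 with hWw
  have hWa1 : ∑ σ, isingW (torusGraph 2 4) σ * a₁ σ ^ 2 = c ^ 2 * W0 + 2 * c * WB + Ww := by
    rw [ha₁_eq, diag_lin]; simp only [one_pow, mul_one, one_mul]; rw [hW0, hWB, hWw]
  rw [hWa1] at hE1
  -- (D) `g n ≤ d (W0 − W(a₁))`, `g = 19/10 − E8`
  have hcmp : c ^ 2 * E8 + Ew - Δ * (c ^ 2 * W0 + 2 * c * WB + Ww) ≤ E8 - Δ * W0 := by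
    rw [hE1]; linarith [hRR]
  have hD : (19 / 10 - E8) * n ≤ d * ((1 - c ^ 2) * W0 - 2 * c * WB - Ww) := by
    rw [hd]
    have e1 : (19 / 10 - E8) * n = 19 / 10 * n - E8 * (1 - c ^ 2) := by rw [hn_eq]; ring
    rw [e1]
    nlinarith [hgap, hcmp]
  -- (E) bounds on the Ising pieces
  have hW0le : W0 ≤ -5/4 := isingMean0_le ha₀
  have hWw : -8 * n ≤ Ww := by
    rw [hWw, hn, Finset.mul_sum]
    exact Finset.sum_le_sum fun σ _ => by nlinarith [isingW_ge_neg_eight σ, sq_nonneg (w σ)]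
  have hWB : WB ^ 2 ≤ 23 / 10 * n := by
    -- `WB = Σ (W + 3/2) a₀ · w` by orthogonality, then Cauchy–Schwarz with the variance bound
    have e : WB = ∑ σ, ((isingW (torusGraph 2 4) σ + 3/2) * a₀ σ) * w σ := by
      rw [hWB]
      have : ∑ σ, ((isingW (torusGraph 2 4) σ + 3/2) * a₀ σ) * w σ = (∑ σ, isingW (torusGraph 2 4) σ * a₀ σ * w σ) + 3/2 * ∑ σ, a₀ σ * w σ := by
        rw [Finset.mul_sum, ← Finset.sum_add_distrib]; exact Finset.sum_congr rfl fun σ _ => by ring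
      rw [this, horth]; ring
    have hcs := Finset.sum_mul_sq_le_sq_mul_sq Finset.univ (fun σ => (isingW (torusGraph 2 4) σ + 3/2) * a₀ σ) w
    have hv := dev32_a0_le ha₀
    have e2 : ∑ σ, ((isingW (torusGraph 2 4) σ + 3/2) * a₀ σ) ^ 2 = ∑ σ, (isingW (torusGraph 2 4) σ + 3/2) ^ 2 * a₀ σ ^ 2 :=
      Finset.sum_congr rfl fun σ _ => by ring
    rw [e2] at hcs
    rw [e]
    calc (∑ σ, (isingW (torusGraph 2 4) σ + 3/2) * a₀ σ * w σ) ^ 2 ≤ (∑ σ, (isingW (torusGraph 2 4) σ + 3/2) ^ 2 * a₀ σ ^ 2) * ∑ σ, w σ ^ 2 := hcs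
      _ ≤ 23 / 10 * n := by rw [← hn]; exact mul_le_mul_of_nonneg_right hv hn0
  -- (F) `n ≤ 1.72 d²`
  have hg : 289 / 100 ≤ 19 / 10 - E8 := by have := e8_zero_le; rw [← hE8] at this; linarith
  have hn_small : n ≤ 172 / 100 * d ^ 2 := by
    -- `(19/10 − E8) n ≤ d((27/4) n + 2 (abs WB))` with `(abs WB)² ≤ 2.3 n`
    have ht0 : 0 ≤ (abs WB) := abs_nonneg _
    have ht2 : (abs WB) ^ 2 ≤ 23 / 10 * n := by rw [sq_abs]; exact hWB
    have hD' : (19 / 10 - E8) * n ≤ d * (27 / 4 * n + 2 * (abs WB)) := by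
      have h3 : (1 - c ^ 2) * W0 - 2 * c * WB - Ww ≤ 27 / 4 * n + 2 * (abs WB) := by
        have hcw : -(2 * c * WB) ≤ 2 * (abs WB) := by
          have h1' := neg_abs_le WB
          have h2' := le_abs_self WB
          nlinarith
        nlinarith [hW0le, hWw, hn_eq, hn0]
      exact le_trans hD (mul_le_mul_of_nonneg_left h3 hd0)
    have hgn : 289 / 100 * n ≤ (19 / 10 - E8) * n := mul_le_mul_of_nonneg_right hg hn0
    have hm : (289 / 100 - 27 / 4 * d) * n ≤ 2 * d * (abs WB) := by linarith
    have hmpos : 463 / 200 ≤ 289 / 100 - 27 / 4 * d := by linarith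
    have hsq : ((289 / 100 - 27 / 4 * d) * n) ^ 2 ≤ (2 * d * (abs WB)) ^ 2 :=
      pow_le_pow_left₀ (mul_nonneg (by linarith) hn0) hm 2
    have h4 : (2 * d * (abs WB)) ^ 2 ≤ 4 * d ^ 2 * (23 / 10 * n) := by
      have := mul_le_mul_of_nonneg_left ht2 (mul_nonneg (by norm_num : (0:ℝ) ≤ 4) (sq_nonneg d))
      calc (2 * d * (abs WB)) ^ 2 = 4 * d ^ 2 * (abs WB) ^ 2 := by ring
        _ ≤ 4 * d ^ 2 * (23 / 10 * n) := this
    rcases hn0.eq_or_lt with hz | hpos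
    · rw [← hz]; positivity
    · -- divide by `n > 0`: `m² n ≤ 9.2 d²`
      have h5 : (289 / 100 - 27 / 4 * d) ^ 2 * n ≤ 46 / 5 * d ^ 2 := by
        have : (289 / 100 - 27 / 4 * d) ^ 2 * n * n ≤ 46 / 5 * d ^ 2 * n := by
          calc (289 / 100 - 27 / 4 * d) ^ 2 * n * n = ((289 / 100 - 27 / 4 * d) * n) ^ 2 := by ring
            _ ≤ 46 / 5 * d ^ 2 * n := by linarith
        exact le_of_mul_le_mul_right this hpos
      have h6 : (463 / 200) ^ 2 * n ≤ (289 / 100 - 27 / 4 * d) ^ 2 * n :=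
        mul_le_mul_of_nonneg_right (pow_le_pow_left₀ (by norm_num) hmpos 2) hn0
      nlinarith [h5, h6, sq_nonneg d]
  -- (G) the condensate: `Λ(a₁) = c²Λ₀ + 2cΛB + Λw ≥ c²Λ₀ − 2|ΛB|`, `ΛB² ≤ Λ₀(289/4 − Λ₀) n`
  obtain ⟨L0, hL0⟩ : ∃ x, x = lowerNormSq a₀ := ⟨_, rfl⟩
  obtain ⟨LB, hLB⟩ : ∃ x, x = ∑ τ, lowerSum a₀ τ * lowerSum w τ := ⟨_, rfl⟩
  obtain ⟨Lw, hLw⟩ : ∃ x, x = lowerNormSq w := ⟨_, rfl⟩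
  have hLa1 : lowerNormSq a₁ = c ^ 2 * L0 + 2 * c * LB + Lw := by
    rw [hL0, hLB, hLw, ha₁_eq, lowerNormSq_lin]; simp only [one_pow, one_mul, mul_one]
  have hLw0 : 0 ≤ Lw := by rw [hLw]; exact Finset.sum_nonneg fun τ _ => sq_nonneg _
  obtain ⟨hL0lo, hL0hi⟩ := lambda0_bounds ha₀
  rw [← hL0] at hL0lo hL0hi
  have hLB : LB ^ 2 ≤ L0 * (289 / 4 - L0) * n := by
    refine cross_sq_le (Λw := Lw) (by linarith) (by linarith) ?_ ?_
    · intro α β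
      have h := lowerNormSq_lin α β a₀ w
      have : 0 ≤ lowerNormSq (fun σ => α * a₀ σ + β * w σ) := Finset.sum_nonneg fun τ _ => sq_nonneg _
      rw [h] at this; rw [hL0, hLB, hLw]; linarith
    · intro α β
      have hsb : SymAmp (fun σ => α * a₀ σ + β * w σ) := hs₀.lin hsw α β
      obtain ⟨hN, -, hL, -⟩ := hsb.forms
      -- ceiling certificate `289 N − 4 L ⪰ 0` on the class space
      have hZ : 0 ≤ ∑ i ∈ range 58, ∑ j ∈ range 58,
          (fun r => α * a₀ (decode (rep8 r)) + β * w (decode (rep8 r))) i * (fun r => α * a₀ (decode (rep8 r)) + β * w (decode (rep8 r))) j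
            * ((pZ i j : ℤ) : ℝ) := by
        have h := psd_of_dominant_residual 58 (2 ^ 12) (by norm_num) pZ cholZ
          (fun i hi j hj => by
            have := allN_sound (allN_sound certSymZ_holds i hi) j hj; rwa [beq_iff_eq] at this)
          (fun i hi => by
            have hrow : decide ((offSumZ i : ℤ) ≤ residZ i i) = true := by
              by_cases hlt : i < 29
              · have := allN_sound certDomZ_lo i hlt; simpa using this
              · have := allN_sound certDomZ_hi (i - 29) (by omega)
                rwa [show 29 * 1 + (i - 29) = i by omega] at this
            rw [decide_eq_true_eq] at hrow
            unfold offSumZ at hrow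
            rw [sumN_eq] at hrow
            unfold residZ at hrow
            simp_rw [iter_add_eq, zero_add] at hrow
            push_cast at hrow
            refine le_trans (le_of_eq (Finset.sum_congr rfl fun j _ => ?_)) hrow
            split_ifs <;> rfl)
          (fun r => α * a₀ (decode (rep8 r)) + β * w (decode (rep8 r)))
        exact h
      have hexp : ∑ i ∈ range 58, ∑ j ∈ range 58,
          (fun r => α * a₀ (decode (rep8 r)) + β * w (decode (rep8 r))) i * (fun r => α * a₀ (decode (rep8 r)) + β * w (decode (rep8 r))) j
            * ((pZ i j : ℤ) : ℝ)
          = 289 * normC (fun r => α * a₀ (decode (rep8 r)) + β * w (decode (rep8 r)))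
            - 4 * lowerC (fun r => α * a₀ (decode (rep8 r)) + β * w (decode (rep8 r))) := by
        have e : ∀ i ∈ range 58, ∀ j ∈ range 58,
            (fun r => α * a₀ (decode (rep8 r)) + β * w (decode (rep8 r))) i * (fun r => α * a₀ (decode (rep8 r)) + β * w (decode (rep8 r))) j
              * ((pZ i j : ℤ) : ℝ)
            = (fun r => α * a₀ (decode (rep8 r)) + β * w (decode (rep8 r))) i * (fun r => α * a₀ (decode (rep8 r)) + β * w (decode (rep8 r))) j
                * (if i = j then (289 : ℝ) * (n8 i : ℝ) else 0)
              - 4 * ((fun r => α * a₀ (decode (rep8 r)) + β * w (decode (rep8 r))) i * (fun r => α * a₀ (decode (rep8 r)) + β * w (decode (rep8 r))) j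
                * ((lLit i j : ℤ) : ℝ)) := by
          intro i _ j _; unfold pZ; push_cast; split_ifs <;> ring
        rw [Finset.sum_congr rfl (fun i hi => Finset.sum_congr rfl (fun j hj => e i hi j hj))]
        simp only [Finset.sum_sub_distrib, ← Finset.mul_sum]
        rw [quad_lLit, quad_diag]
        unfold normC; rw [Finset.mul_sum]
        congr 1; exact Finset.sum_congr rfl fun r _ => by ring
      rw [hexp, ← hN, ← hL, lowerNormSq_lin] at hZ
      have e : ∀ σ, (α * a₀ σ + β * w σ) ^ 2 = α ^ 2 * a₀ σ ^ 2 + 2 * α * β * (a₀ σ * w σ) + β ^ 2 * w σ ^ 2 := by intro σ; ring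
      simp only [e, Finset.sum_add_distrib, ← Finset.mul_sum, ha₀.unit, horth] at hZ
      rw [← hn, ← hL0, ← hLB, ← hLw] at hZ
      linarith
  -- (H) final arithmetic: `(1 − d) L0 ≤ c² L0 + 2 c LB + Lw`
  rw [show (1 + Δ) = 1 - d by rw [hd]; ring, hLa1]
  have hc2 : c ^ 2 = 1 - n := by linarith
  -- it suffices that `2(abs LB) ≤ L0 (d − n)` (then use `c ≤ 1`, `Lw ≥ 0`)
  have hdn : n ≤ d := by nlinarith
  have hLBabs : 4 * LB ^ 2 ≤ (L0 * (d - n)) ^ 2 := by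
    have h6 : 4 * (L0 * (289 / 4 - L0) * n) ≤ (L0 * (d - n)) ^ 2 := by
      -- `4(289/4 − L0) n ≤ L0 (d − n)²` with `L0 ≥ 66.5`, `289/4 − L0 ≤ 23/4`, `n ≤ 1.72 d²`, `d ≤ 17/200`
      have h7 : 4 * (289 / 4 - L0) * n ≤ 23 * (172 / 100 * d ^ 2) := by
        have : (289 / 4 - L0) * n ≤ 23 / 4 * n := mul_le_mul_of_nonneg_right (by linarith) hn0
        linarith
      have h10 : 0 ≤ d - 172 / 100 * d ^ 2 := by nlinarith
      have h9 : d - 172 / 100 * d ^ 2 ≤ d - n := by linarith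
      have h11 : (d - 172 / 100 * d ^ 2) ^ 2 ≤ (d - n) ^ 2 := pow_le_pow_left₀ h10 h9 2
      have h12 : 8538 / 10000 ≤ 1 - 172 / 100 * d := by linarith
      have h13 : (8538 / 10000) ^ 2 * d ^ 2 ≤ (d - 172 / 100 * d ^ 2) ^ 2 := by
        have := mul_le_mul_of_nonneg_right (pow_le_pow_left₀ (by norm_num) h12 2) (sq_nonneg d)
        calc (8538 / 10000 : ℝ) ^ 2 * d ^ 2 ≤ (1 - 172 / 100 * d) ^ 2 * d ^ 2 := this
          _ = (d - 172 / 100 * d ^ 2) ^ 2 := by ring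
      have h8 : 133 / 2 * ((8538 / 10000) ^ 2 * d ^ 2) ≤ L0 * (d - n) ^ 2 := by
        calc 133 / 2 * ((8538 / 10000 : ℝ) ^ 2 * d ^ 2) ≤ 133 / 2 * (d - n) ^ 2 := by linarith
          _ ≤ L0 * (d - n) ^ 2 := mul_le_mul_of_nonneg_right hL0lo (sq_nonneg _)
      have h14 : 4 * (L0 * (289 / 4 - L0) * n) = L0 * (4 * (289 / 4 - L0) * n) := by ring
      have h15 : L0 * (4 * (289 / 4 - L0) * n) ≤ L0 * (23 * (172 / 100 * d ^ 2)) := mul_le_mul_of_nonneg_left h7 (by linarith)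
      have h16 : (L0 * (d - n)) ^ 2 = L0 * (L0 * (d - n) ^ 2) := by ring
      have h17 : L0 * (133 / 2 * ((8538 / 10000) ^ 2 * d ^ 2)) ≤ L0 * (L0 * (d - n) ^ 2) := mul_le_mul_of_nonneg_left h8 (by linarith)
      rw [h14, h16]
      nlinarith [h15, h17, sq_nonneg d]
    linarith [hLB]
  have hLB' : 2 * (abs LB) ≤ L0 * (d - n) := by
    have hr : 0 ≤ L0 * (d - n) := mul_nonneg (by linarith) (by linarith)
    have : (2 * (abs LB)) ^ 2 ≤ (L0 * (d - n)) ^ 2 := by rw [mul_pow, sq_abs]; linarith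
    nlinarith [this, hr, abs_nonneg LB]
  nlinarith [hLB', neg_abs_le LB, le_abs_self LB, hLw0, hc0, hc1]

end Summit.HubbardSuperconductivity.HubbardSuperconductivity.Theorems.AnisotropyChord.FourTorus
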